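import Summits.NavierStokesRegularity.NavierStokesRegularity.Theorems.SoloSalvageWu2026TangentLimit
import Mathlib.Analysis.MeanInequalitiesPow
import HarnessLib

/-!
# C177 `Wu2026` — SALVAGE, TRUE column: `Q_jV_j → QV` in `L¹_loc(ℝ³ ∖ {0})` along the Euler
# blow-down tangent (first limit of (3.85)) (D-0090 NS-CLAIMS, LADDER row rung 3; salvage seat
# `ns-claims-salvage-p3`)

Fourth helper toward the binder `Literature.Claims.NS.Wu2026.Step_385`. For a flow `(v, p)` and an
Euler blow-down tangent `T : Tangent ν v p` of the skeleton (p558978), with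
`V_j = blowDown R_j v`, `P_j = blowDownP R_j (p − c)`, `Q_j = P_j + |V_j|²/2`, `Q = P + |V|²/2`:
for every compact `K ⊆ ℝ³ ∖ {0}`, `∫_K |Q_jV_j − QV| → 0` (`tendsto_lintegral_bernV_sub`) — the
print's «By (3.28), (3.45), and q₀ > 3, we have Q_jV_j → QV in L¹_loc(ℝ³ ∖ {0})» (p.26 l.68–70).
Inputs: `Tangent.convV` (3.28), `Tangent.convP` (3.45), `Tangent.locInt`, `Tangent.hq0`, read in
`ℝ≥0∞` form (`tendsto_lintegral_V_sub`, `tendsto_lintegral_P_sub`), and the abstract six-term Hölder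
limit `tendsto_lintegral_six_terms` of `SoloSalvageWu2026TangentLimit`.

Theorems only, standard axioms, no `sorry`.

WHAT THIS IS NOT: not a claim about NS regularity or blow-up; not a claim about any author beyond the
typed locator.
-/

set_option linter.dupNamespace false

noncomputable section

open MeasureTheory Set Filter Topology Module Metric
open scoped ENNReal NNReal Topology RealInnerProductSpace

namespace Summit.NavierStokesRegularity.NavierStokesRegularity.Theorems.Wu2026Salvage

open Literature.Analysis.FluidPDE Literature.Analysis.FunctionSpaces Literature.Claims.NS.Wu2026

/-! ## Elementary facts on the rescaled fields -/

/-- The good scales are positive: `R_j = 2^{n_j} > 0`. [cite: Wu2026, (3.16) p.9] -/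
theorem tangent_R_pos {ν : ℝ} {v : E3 → E3} {p : E3 → ℝ} (T : Tangent ν v p) (j : ℕ) :
    0 < T.R j :=
  pow_pos two_pos _

/-- The blow-down of a continuous field is continuous. [cite: Wu2026, (3.19) p.10] -/
theorem continuous_blowDown {v : E3 → E3} (hv : Continuous v) (R : ℝ) :
    Continuous (blowDown R v) := by
  unfold blowDown
  exact (hv.comp (continuous_const_smul R)).const_smul (R ^ ((2 : ℝ) / 3))

/-- The rescaled pressure of a continuous pressure is continuous. [cite: Wu2026, (3.38) p.14] -/
theorem continuous_blowDownP {q : E3 → ℝ} (hq : Continuous q) (R : ℝ) :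
    Continuous (blowDownP R q) := by
  unfold blowDownP
  exact continuous_const.mul (hq.comp (continuous_const_smul R))

/-- `∫⁻_K ‖g − f‖ₑ^r < ∞` for `g` continuous, `|f|^r` integrable on the compact `K`, `r ≥ 1`. [folklore] -/
theorem lintegral_enorm_sub_rpow_lt_top {F' : Type*} [NormedAddCommGroup F'] {g f : E3 → F'}
    (hg : Continuous g) {K : Set E3} (hK : IsCompact K) {r : ℝ} (hr : 1 ≤ r)
    (hfK : IntegrableOn (fun y => ‖f y‖ ^ r) K volume) :
    ∫⁻ y in K, ‖g y - f y‖ₑ ^ r < ∞ := by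
  have hr0 : 0 ≤ r := by linarith
  have hgm : AEMeasurable (fun y => ‖g y‖ₑ ^ r) (volume.restrict K) :=
    (hg.aestronglyMeasurable.enorm.pow_const r).restrict
  calc ∫⁻ y in K, ‖g y - f y‖ₑ ^ r ≤ ∫⁻ y in K, 2 ^ (r - 1) * (‖g y‖ₑ ^ r + ‖f y‖ₑ ^ r) :=
        lintegral_mono fun y => (ENNReal.rpow_le_rpow enorm_sub_le hr0).trans
          (ENNReal.rpow_add_le_mul_rpow_add_rpow _ _ hr)
    _ = 2 ^ (r - 1) * ((∫⁻ y in K, ‖g y‖ₑ ^ r) + ∫⁻ y in K, ‖f y‖ₑ ^ r) := by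
        rw [lintegral_const_mul' _ _ (ENNReal.rpow_ne_top_of_nonneg (by linarith) ENNReal.ofNat_ne_top),
          lintegral_add_left' hgm]
    _ < ∞ := ENNReal.mul_lt_top (ENNReal.rpow_lt_top_of_nonneg (by linarith) ENNReal.ofNat_ne_top)
          (ENNReal.add_lt_top.2 ⟨lintegral_enorm_rpow_lt_top_of_continuous hg hK hr0,
            lintegral_enorm_rpow_lt_top_of_integrableOn hr0 hfK⟩)

/-! ## (3.28) and (3.45) in `ℝ≥0∞` form -/

section Tangent

variable {ν : ℝ} {v : E3 → E3} {p : E3 → ℝ}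

/-- **(3.28)** in `ℝ≥0∞` form: `∫⁻_K ‖V_j − V‖ₑ^{q₀} → 0` for compact `K ⊆ ℝ³ ∖ {0}`. [cite: Wu2026, (3.28) p.11 l.44–50] -/
theorem tendsto_lintegral_V_sub (hflow : IsWuFlow ν v p) (T : Tangent ν v p) {K : Set E3}
    (hK : IsCompact K) (hKp : K ⊆ punctured) :
    Tendsto (fun j => ∫⁻ y in K, ‖blowDown (T.R j) v y - T.V y‖ₑ ^ T.q0) atTop (𝓝 0) := by
  have hq1 : 1 ≤ T.q0 := by linarith [T.hq0.1]
  have hq0 : 0 ≤ T.q0 := by linarith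
  have hVj : ∀ j, Continuous (blowDown (T.R j) v) := fun j =>
    continuous_blowDown hflow.smooth_v.continuous _
  have hV : AEStronglyMeasurable T.V volume := T.locInt.1
  have hVK : IntegrableOn (fun y => ‖T.V y‖ ^ T.q0) K volume := (T.locInt.2.2 K hK hKp).1
  have heq : ∀ j, ∫⁻ y in K, ‖blowDown (T.R j) v y - T.V y‖ₑ ^ T.q0 =
      ∫⁻ y in K, ENNReal.ofReal (‖blowDown (T.R j) v y - T.V y‖ ^ T.q0) := fun j =>
    lintegral_congr fun y => (ofReal_norm_rpow _ hq0).symm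
  simp_rw [heq]
  refine tendsto_lintegral_of_tendsto_integral (fun j y => by positivity) (fun j => ?_) (fun j => ?_)
    (T.convV K hK hKp)
  · exact (((hVj j).aestronglyMeasurable.sub hV).norm.aemeasurable.pow_const _).aestronglyMeasurable.restrict
  · rw [← heq j]
    exact (lintegral_enorm_sub_rpow_lt_top (hVj j) hK hq1 hVK).ne

/-- **(3.45)** in `ℝ≥0∞` form: `∫⁻_K ‖P_j − P‖ₑ^{q₀/2} → 0` for compact `K ⊆ ℝ³ ∖ {0}`, with the
canonical pressure `p − c`. [cite: Wu2026, (3.45) p.16 l.21–27] -/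
theorem tendsto_lintegral_P_sub (hflow : IsWuFlow ν v p) (T : Tangent ν v p) {K : Set E3}
    (hK : IsCompact K) (hKp : K ⊆ punctured) :
    Tendsto (fun j => ∫⁻ y in K,
      ‖blowDownP (T.R j) (fun x => p x - T.c) y - T.P y‖ₑ ^ (T.q0 / 2)) atTop (𝓝 0) := by
  have hq1 : 1 ≤ T.q0 / 2 := by linarith [T.hq0.1]
  have hq0 : 0 ≤ T.q0 / 2 := by linarith
  have hqc : Continuous fun x => p x - T.c := hflow.smooth_p.continuous.sub continuous_const
  have hPj : ∀ j, Continuous (blowDownP (T.R j) (fun x => p x - T.c)) := fun j =>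
    continuous_blowDownP hqc _
  have hP : AEStronglyMeasurable T.P volume := T.locInt.2.1
  have hPK : IntegrableOn (fun y => ‖T.P y‖ ^ (T.q0 / 2)) K volume := by
    simpa only [Real.norm_eq_abs] using (T.locInt.2.2 K hK hKp).2
  have heq : ∀ j, ∫⁻ y in K, ‖blowDownP (T.R j) (fun x => p x - T.c) y - T.P y‖ₑ ^ (T.q0 / 2) =
      ∫⁻ y in K, ENNReal.ofReal
        (|blowDownP (T.R j) (fun x => p x - T.c) y - T.P y| ^ (T.q0 / 2)) := fun j =>
    lintegral_congr fun y => by rw [← Real.norm_eq_abs]; exact (ofReal_norm_rpow _ hq0).symm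
  simp_rw [heq]
  refine tendsto_lintegral_of_tendsto_integral (fun j y => by positivity) (fun j => ?_) (fun j => ?_)
    (T.convP K hK hKp)
  · exact (((hPj j).aestronglyMeasurable.sub hP).norm.aemeasurable.pow_const
      (T.q0 / 2)).aestronglyMeasurable.restrict
  · rw [← heq j]
    exact (lintegral_enorm_sub_rpow_lt_top (hPj j) hK hq1 hPK).ne

/-! ## `Q_jV_j → QV` in `L¹(K)` -/

/-- **First limit of (3.85)**: along the Euler blow-down tangent, `∫_K |Q_jV_j − QV| → 0` for every
compact `K ⊆ ℝ³ ∖ {0}` («By (3.28), (3.45), and q₀ > 3, we have Q_jV_j → QV in L¹_loc(ℝ³ ∖ {0})»).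
[cite: Wu2026, (3.85) proof p.26 l.68–76] -/
theorem tendsto_lintegral_bernV_sub (hflow : IsWuFlow ν v p) (T : Tangent ν v p) {K : Set E3}
    (hK : IsCompact K) (hKp : K ⊆ punctured) :
    Tendsto (fun j => ∫⁻ y in K,
      ‖bern (blowDown (T.R j) v) (blowDownP (T.R j) (fun x => p x - T.c)) y • blowDown (T.R j) v y -
        bern T.V T.P y • T.V y‖ₑ) atTop (𝓝 0) := by
  have hq3 : 3 < T.q0 := T.hq0.1
  have hqc : Continuous fun x => p x - T.c := hflow.smooth_p.continuous.sub continuous_const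
  have hVj : ∀ j, Continuous (blowDown (T.R j) v) := fun j =>
    continuous_blowDown hflow.smooth_v.continuous _
  have hPj : ∀ j, Continuous (blowDownP (T.R j) (fun x => p x - T.c)) := fun j =>
    continuous_blowDownP hqc _
  have hV : AEStronglyMeasurable T.V volume := T.locInt.1
  have hP : AEStronglyMeasurable T.P volume := T.locInt.2.1
  -- the `ℝ≥0∞` data of the six-term lemma
  have hd : ∀ j, AEMeasurable (fun y => ‖blowDown (T.R j) v y - T.V y‖ₑ) (volume.restrict K) :=
    fun j => ((hVj j).aestronglyMeasurable.sub hV).enorm.restrict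
  have he : ∀ j, AEMeasurable (fun y => ‖blowDownP (T.R j) (fun x => p x - T.c) y - T.P y‖ₑ)
      (volume.restrict K) := fun j => ((hPj j).aestronglyMeasurable.sub hP).enorm.restrict
  have hVm : AEMeasurable (fun y => ‖T.V y‖ₑ) (volume.restrict K) := hV.enorm.restrict
  have hPm : AEMeasurable (fun y => ‖T.P y‖ₑ) (volume.restrict K) := hP.enorm.restrict
  have hVq : ∫⁻ y in K, ‖T.V y‖ₑ ^ T.q0 ≠ ∞ :=
    (lintegral_enorm_rpow_lt_top_of_integrableOn (by linarith) (T.locInt.2.2 K hK hKp).1).ne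
  have hPK : IntegrableOn (fun y => ‖T.P y‖ ^ (T.q0 / 2)) K volume := by
    simpa only [Real.norm_eq_abs] using (T.locInt.2.2 K hK hKp).2
  have hPq : ∫⁻ y in K, ‖T.P y‖ₑ ^ (T.q0 / 2) ≠ ∞ :=
    (lintegral_enorm_rpow_lt_top_of_integrableOn (by linarith) hPK).ne
  have hsix := tendsto_lintegral_six_terms hK.measure_lt_top.ne hd he hVm hPm hq3 hVq hPq
    (tendsto_lintegral_V_sub hflow T hK hKp) (tendsto_lintegral_P_sub hflow T hK hKp)
  exact tendsto_zero_of_le hsix fun j => lintegral_mono fun y => enorm_bernV_sub_le _ _ _ _ y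

end Tangent

end Summit.NavierStokesRegularity.NavierStokesRegularity.Theorems.Wu2026Salvage

end

-- WHAT THIS IS NOT: not a claim about NS regularity or blow-up; not a claim about any author beyond the typed locator.
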